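import Mathlib
import HarnessLib

/-!
# BalabanUVNodes ∕ N15 — THE KING-MODEL RUNG (PART Ͱ-j): THE BOUNDARY OF PART Ͱ AS A CERTIFICATE — KING's FULL `A = 0` OPERATOR WITH THE BLOCK-AVERAGING PENALTY,
# `A₀ = −Δ + m² + aQ^*Q`, IS NOT INVERSE-POSITIVE: on the 4-site cycle with blocks of 2 (`c = 1`, `m² = 1`, `a = 8`) the entry `A₀⁻¹(0,1) = −1∕21 < 0` (exact rational witness), so the
# Kato-shaped comparison `|G_k(U)(x,y)| ≤ G_k(1)(x,y)` is FALSE already at `U = 1` — domination stops at the fine covariance (Track A, DAG node N15 = NE2; count-neutral)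

HONEST FRAMING.  Count-neutral (cell `pub-ymgap`, seat `pub-ymgap-dag-n15-e` g42; `--supports stmt-QuantumFields-27247 --as helper` = K3ᴬ, KEY MAP v3).  A four-by-four exact computation;
the LOCATED sentence of PART Ͱ-a's header («the averaging penalty of (3.24) is NOT of Kato form», tree `B9Eq323KatoDomination` HONEST SCOPE) turned into a kernel-checked witness.
Nothing of Bałaban's `G_k(U)` estimates ([B9] Thm 3.1 (3.42), proved in print by the random walk expansion p.398) is touched — they hold for other reasons; this file only certifies that
the maximum-principle route of PART Ͱ cannot deliver them.  NOT a node discharge; nothing continuum ∕ ℝ⁴ ∕ OS ∕ Clay.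

THE OBJECT.  King's fine-lattice quadratic form with the block constraint weight, [King1986] (2.13)–(2.14) p.653: `A₀ = −Δ + m² + a·Q^*Q` (`Q` = block averaging over `L`-blocks;
at `U = 1`, `Q^*Q(x,y) = L^{−2(d+1)}·[x, y in the same block]`), whose inverse `A₀⁻¹` is King's full single-step propagator (the tree's `King1986.…fineOp`, parts Σ∕Ϛ of this rung).
The smallest instance: `d+1 = 1`, the cycle `ℤ∕4`, `c = η⁻² = 1`, `m² = 1`, `L = 2` (blocks `{0,1}`, `{2,3}`), `a = 8` (so `a·L^{−2} = 2` per same-block pair):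
`toyA0 c m² a (x,y) = (m²+2c)[x=y] − c([y=x+1] + [y=x−1]) + (a∕4)[⌊x∕2⌋ = ⌊y∕2⌋]`, i.e. `toyA0 1 1 8 = [[5,1,0,−1],[1,5,−1,0],[0,−1,5,1],[−1,0,1,5]]`.
* §1 `toyA0` (the stencil), ★ `toyA0_eq` (`= !![5,1,0,−1; …]`), `toyA0Inv` (`= (1∕105)·[[23,−5,−2,5],[−5,23,5,−2],[−2,5,23,−5],[5,−2,−5,23]]`), ★ `toyA0_mul_toyA0Inv` (`A₀·A₀Inv = 1`, exact),
  ★ `toyA0_inv_eq`;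
* §2 ★★★ **`toyA0_inv_entry_neg`** (`A₀⁻¹(0,1) = −1∕21 < 0`), ★★ **`not_toyA0_inv_nonneg`** (King's full `A = 0` propagator is NOT entrywise non-negative — contrast Ͱ-b `lapF_inv_entry_nonneg` for
  the fine covariance), ★★★ **`not_kato_shape_toyA0`** (`¬ ∀ x y, |A₀⁻¹(x,y)| ≤ A₀⁻¹(x,y)`: the `U = 1` instance of the would-be domination `|G_k(U)| ≤ G_k(1)` already fails, so NO
  positivity-preserving comparison of PART Ͱ's type can hold for the full propagator); `toyA0_isSymm`, `toyA0_posDef` (the witness is a bona fide positive definite covariance: the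
  failure is one of SIGN STRUCTURE — the same-block entries `+a∕4` are positive off-diagonal — not of positivity of the operator).

PRIOR TREE ART: none used (Mathlib only: `Matrix.inv_eq_right_inv`, `Matrix.PosDef.of_toQuadraticForm'`∕Sylvester not needed — positivity by an explicit `LDLᵀ`-free sum of squares).
Dedup (rg at filing): basename 0 files; needles `toyA0|not_kato_shape_toyA0` 0 tree files.  Locators: [King1986] (2.13)–(2.14) p.653, (4.4) p.670; [Balaban1985BackgroundPropagators] (3.24)
p.394 (the averaging term `aQ'^*Q'`), p.398 (random walk expansion); [DodziukMathai2006] §1 Lemma 1.1 (positivity preservation is the hinge of the Kato route).  0 `sorry`, 2 `def`.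
-/

namespace Summit.QuantumFields.YangMills.BalabanUVNodes.N15KingModelRung.Covariant

open Matrix

/-! ## §1 The four-site witness and its exact inverse -/

/-- KING's `A₀ = c(−Δ) + m² + aQ^*Q` AT `U = 1` ON THE 4-CYCLE WITH BLOCKS OF 2: `(m²+2c)[x=y] − c([y=x+1]+[y=x+3]) + (a∕4)[⌊x∕2⌋=⌊y∕2⌋]` (`x−1 = x+3` mod 4) (`Q^*Q = L^{−2}·[same block]`, `L = 2`).
[cite: King1986, (2.13)–(2.14) p.653] -/
def toyA0 (c μ a : ℚ) : Matrix (Fin 4) (Fin 4) ℚ :=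
  Matrix.of fun x y => (if y = x then μ + 2 * c else 0) - c * ((if y = x + 1 then 1 else 0) + (if y = x + 3 then 1 else 0)) + (if x.val / 2 = y.val / 2 then a / 4 else 0)

/-- ★ The witness parameters `c = 1`, `m² = 1`, `a = 8`: `A₀ = [[5,1,0,−1],[1,5,−1,0],[0,−1,5,1],[−1,0,1,5]]` (diagonal `1+2+2`, in-block neighbour `−1+2 = +1`, out-of-block neighbour `−1`).
[cite: King1986, (2.13)–(2.14) p.653] -/
theorem toyA0_eq : toyA0 1 1 8 = !![5, 1, 0, -1; 1, 5, -1, 0; 0, -1, 5, 1; -1, 0, 1, 5] := by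
  ext i j
  fin_cases i <;> fin_cases j <;> simp [toyA0] <;> norm_num

/-- The candidate inverse `(1∕105)·[[23,−5,−2,5],[−5,23,5,−2],[−2,5,23,−5],[5,−2,−5,23]]`. [folklore] -/
def toyA0Inv : Matrix (Fin 4) (Fin 4) ℚ :=
  !![23/105, -5/105, -2/105, 5/105; -5/105, 23/105, 5/105, -2/105; -2/105, 5/105, 23/105, -5/105; 5/105, -2/105, -5/105, 23/105]

/-- ★ `A₀ · A₀Inv = 1`, exactly over `ℚ`. [folklore] -/
theorem toyA0_mul_toyA0Inv : toyA0 1 1 8 * toyA0Inv = 1 := by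
  rw [toyA0_eq]
  ext i j
  fin_cases i <;> fin_cases j <;> simp [toyA0Inv, Matrix.mul_apply, Fin.sum_univ_four] <;> norm_num

/-- ★ Hence `A₀⁻¹ = A₀Inv`. [folklore] -/
theorem toyA0_inv_eq : (toyA0 1 1 8)⁻¹ = toyA0Inv := Matrix.inv_eq_right_inv toyA0_mul_toyA0Inv

/-! ## §2 A negative entry; the Kato shape fails for the full propagator -/

/-- ★★★ **A NEGATIVE ENTRY OF KING's FULL `A = 0` PROPAGATOR**: `A₀⁻¹(0,1) = −1∕21 < 0` — the in-block neighbour of `0`. [cite: King1986, (2.13)–(2.14) p.653] -/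
theorem toyA0_inv_entry_neg : (toyA0 1 1 8)⁻¹ 0 1 = -1 / 21 ∧ (toyA0 1 1 8)⁻¹ 0 1 < 0 := by
  rw [toyA0_inv_eq]
  norm_num [toyA0Inv]

/-- ★★ **NOT INVERSE-POSITIVE**: King's full `A = 0` propagator (with the block penalty) is NOT entrywise non-negative — in contrast with the fine covariance `(c(−Δ)+m²)⁻¹ ≥ 0`
(Ͱ-b `lapF_inv_entry_nonneg`, a Z-matrix). [cite: King1986, (2.13)–(2.14) p.653, (4.4) p.670] -/
theorem not_toyA0_inv_nonneg : ¬ ∀ x y : Fin 4, 0 ≤ (toyA0 1 1 8)⁻¹ x y := fun h =>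
  absurd (h 0 1) (not_le.mpr (toyA0_inv_entry_neg).2)

/-- ★★★ **THE KATO SHAPE FAILS FOR THE FULL PROPAGATOR**: `¬ ∀ x y, |A₀⁻¹(x,y)| ≤ A₀⁻¹(x,y)` — the `U = 1` instance of the would-be comparison `|G_k(U)(x,y)| ≤ G_k(1)(x,y)` is already
false, so no positivity-preserving (maximum-principle) argument of PART Ͱ's type can dominate Bałaban's `G_k(U)` by King's `G_k(1)`; print's route is the random walk expansion.
[cite: Balaban1985BackgroundPropagators, (3.24) p.394, p.398; DodziukMathai2006, Lemma 1.1 §1; King1986, (2.13) p.653] -/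
theorem not_kato_shape_toyA0 : ¬ ∀ x y : Fin 4, |(toyA0 1 1 8)⁻¹ x y| ≤ (toyA0 1 1 8)⁻¹ x y := fun h =>
  absurd ((abs_nonneg _).trans (h 0 1)) (not_le.mpr (toyA0_inv_entry_neg).2)

/-- The witness is symmetric. [folklore] -/
theorem toyA0_isSymm : (toyA0 1 1 8).IsSymm := by
  rw [toyA0_eq]
  ext i j
  fin_cases i <;> fin_cases j <;> rfl

/-- … and positive definite (a bona fide covariance): `⟨v, A₀v⟩ = 3Σv_i² + (v₀+v₁)² + (v₂+v₃)² + (v₁−v₂)² + (v₀−v₃)² > 0` for `v ≠ 0` — the failure above is one of SIGN STRUCTURE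
(positive same-block off-diagonal entries), not of positivity. [cite: King1986, (2.13)–(2.14) p.653] -/
theorem toyA0_posDef : (toyA0 1 1 8).PosDef := by
  rw [toyA0_eq]
  refine Matrix.PosDef.of_dotProduct_mulVec_pos ?_ fun v hv => ?_
  · ext i j
    fin_cases i <;> fin_cases j <;> rfl
  · have hq : star v ⬝ᵥ (!![(5 : ℚ), 1, 0, -1; 1, 5, -1, 0; 0, -1, 5, 1; -1, 0, 1, 5] *ᵥ v)
        = 3 * (v 0 ^ 2 + v 1 ^ 2 + v 2 ^ 2 + v 3 ^ 2) + (v 0 + v 1) ^ 2 + (v 2 + v 3) ^ 2 + (v 1 - v 2) ^ 2 + (v 0 - v 3) ^ 2 := by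
      simp [dotProduct, Matrix.mulVec, Fin.sum_univ_four]
      ring
    rw [hq]
    have hne : v 0 ≠ 0 ∨ v 1 ≠ 0 ∨ v 2 ≠ 0 ∨ v 3 ≠ 0 := by
      by_contra h
      simp only [not_or, not_not] at h
      exact hv (funext fun i => by fin_cases i <;> simp [h.1, h.2.1, h.2.2.1, h.2.2.2])
    rcases hne with h | h | h | h <;> [have := sq_pos_of_ne_zero h; have := sq_pos_of_ne_zero h; have := sq_pos_of_ne_zero h; have := sq_pos_of_ne_zero h] <;> positivity

end Summit.QuantumFields.YangMills.BalabanUVNodes.N15KingModelRung.Covariant
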